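import Summits.QuantumFields.BalabanUV.T4Continuum.Support.NE3ShapeClassSixTorus
import Summits.QuantumFields.BalabanUV.T4Continuum.Support.BlockAverageCurrent
import HarnessLib

/-!
# T⁴ programme, node NE3 (η-rate of the minimisers) — THE ACTION SANDWICH, final assembly, part 4d:
# ROUTE (A) OVER B11's CLASS (6) AS PRINTED RESTS ON B11 THEOREM 1 TYPE ALONE — (M2) DISCHARGED

NE3 prover lineage P1, gen 19 (cell `pub-balaban`, unit `b2b-balaban-t4-ne3-p1`, row NE3 OWNER).

Part 4c (`MinimalActionMemClass.actionRate_classSix_thm1Type`) and its two-readings twin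
(`NE3ShapeClassSixTorus.ne3Shape_classSix_crude`) carried, over Bałaban's class (6) AS PRINTED (`MinimalActionClassSix.ClassSix`:
`U(N)`-valued, periodic, plaquette condition (1.7) AND lattice-current condition (1.9) at all levels), ONE typed hypothesis besides
(H∃) and T-E: (M2) «the one-step average (42) of a `(b, c)`-regular run-`(k+1)` minimiser, read on the next lattice, lies in (6) at
level `k`» ([Balaban1985RegularSpaces] Prop. 3 ∕ [Balaban1985Averaging] (128)–(129) TYPE).  The crew's `BlockAverageCurrent.classSix_h4`
(swarm seat leaf-05 g3, S3-D7) proves (M2) as pure KINEMATICS of (42) for EVERY sup-regular configuration, k-uniformly, under the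
regime (Rb) and the two class thresholds `b + 226(8(d+1)(d+4))²b² < ε₀`, `2(d−1)(c + curConst d L·b²) < ε₀`.  This file plugs it in.

CONTENT (0 def, 0 sorry):
§1 `rb_of_T2` ((Rb) for `b ≤ t` from threshold (ii)); `plaq_threshold_le`, `cur_threshold_le` (the two class thresholds from
   `b, c ≤ t ≤ 1` and ONE letter each: `(1 + 14464(d+1)²(d+4)²)·t`, `2(d−1)(1 + curConst d L)·t`);
§2 **`actionRate_classSix_of_thm1Type`** — THE END OF ROUTE (A) OVER CLASS (6): (H∃) over `ClassSix d L N ε₀` + `0 ≤ b, c ≤ t` +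
   thresholds (i)–(iii) of part 4b + the refined competitor's radii `(B, C_r)` with `(K_b + 8K_mL^{d+2})t ≤ B ≤ 1/4`, `B < ε₀`,
   `(K_c + 36K_mL^{d+2})t ≤ C_r ≤ 1`, `2(d−1)C_r < ε₀` + the averaged competitor's thresholds `b + 226(8(d+1)(d+4))²b² < ε₀`,
   `2(d−1)(c + curConst d L·b²) < ε₀` ⇒ `ActionRate (minActReadings d (ClassSix d L N ε₀) L N dom loc) (wallConstNA(d,L)(gradConst d 1
   + 1)/L²) (L⁻²)`; **`actionRate_classSix_of_thm1Type_small`** — the same with `(B, C_r)` INSTANTIATED at their thresholds and every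
   side condition a displayed polynomial in `(d, L)` times `t`, against `1`, `1/4` or `ε₀`: (H∃) + NINE numeric inequalities in the
   letters `t, ε₀` ONLY;
§3 **`ne3Shape_classSix_of_energyRate`** — BOTH READINGS BY NAME on the fixed torus over class (6) (`d = 4`, `L ≥ 2`):
   (H∃)[choice form] ∧ T-E ∧ regime ⇒ `NE3Shape (minActReadings d (ClassSix d L N ε₀) L N dom loc_D) (max C_A K_D) (L⁻¹)` — the
   (M2) binder of `ne3Shape_classSix_crude` discharged the same way;
§4 non-vacuity of the (H∃)-free part: `actionRate_classSix_of_thm1Type_flat` (t = 0, flat datum; (H∃) by the flat configuration,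
   which is its own average and lies in (6) for every `ε₀ > 0`; cf. the crew's `NE3ClassSixFlatWitness`, leaf-04 g3).

WHERE ROUTE (A) STANDS AFTER THIS FILE.  Over `sfClass ε` (part 4b) AND over B11's class (6) as printed (here) the η-rate of the
minimal actions follows from ONE typed hypothesis, (H∃) = [Balaban1985Variational] Thm 1 (8)+(9)+(10) p. 279 TYPE — over class (6)
LITERALLY Bałaban's variational problem in the everywhere-small-field case; everything else (deficit identity and wall, B7 Prop. 1,
the kinematic refinement and its chain-end exactness, the regime, (M1), (M2)) is a kernel theorem.  D-s3-1 is CLOSED for route (A).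

HONEST FRAMING.  **NE3 is NOT proved**: (H∃) is a HYPOTHESIS over the tree's objects, asserted nowhere; T-E (§3) is P2's ROOT,
asserted only for the flat class; the (D) constant is the crude fixed-torus one (`∝ N⁴`); nothing printed is a hypothesis of a
theorem; no conditional of the cell (`BetaPertH`, (B), (B^μ), G-an2-4); no `def`, no `sorry`, axioms ⊆ {propext, Classical.choice,
Quot.sound}.  Finite T⁴ rung (B)+1 — NOT infinite volume, NOT a mass gap, NOT the Clay problem, NOT summit progress.  PLACEMENT:
`Summits/QuantumFields/BalabanUV/`.  HONEST DEPENDENCY (cell page 1): continuum YM on T⁴ ⇐ BetaPertH ∧ nine spine estimates (0/9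
proved); BetaPertH ⇐ (D1) ∧ (D4) ∧ CAP+tail; G-an2-4 gates asym, D1 and NE2/3/4.
-/

set_option autoImplicit false

open scoped BigOperators Matrix Matrix.Norms.L2Operator
open NormedSpace Finset

namespace Summit.QuantumFields.BalabanUV.T4Continuum.MinimalActionClassSixEnd

open Literature.MathematicalPhysics.QuantumFieldTheory.Balaban1983to89
open B7Prop1Explicit B7Prop2Explicit
open T4AveragingDeficitWall hiding Site Plane Plaq Bond
open T4AveragingDeficitWallBoundary (periodBox)
open T4AveragingDeficitNonAbelian (wallConstNA wallConstNA_nonneg wallConstLoc)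
open AveragingDeficitDualResidual (dualC1 dualC2)
open AveragingDeficitDerivWallProof (wallConst)
open T4EtaRateMin (ActionRate NE3Shape)
open MinimalActionSandwich MinimalActionRate MinimalActionRefine MinimalActionWitness
open SkeletonPrecompGrad (gradRem gradRem_nonneg)
open NE3EnergyShapes (NE3EnergyRate)
open MinimalActionMemClass (actionRate_classSix_thm1Type)
open MinimalActionClassSix (ClassSix mem_classSix_of_regularSup flatCfg_mem_classSix classSix_subset_sfClass)
open NE3ShapeClassSixTorus (ne3Shape_classSix_crude)
open BlockAverageCurrent (curConst curConst_nonneg classSix_h4)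

noncomputable section

variable {d : ℕ} {n : Type*} [Fintype n] [DecidableEq n] [Nonempty n]

/-! ## §1 Arithmetic of the thresholds -/

omit [Fintype n] [DecidableEq n] [Nonempty n] in
/-- Threshold (ii) `2¹⁵(d+1)²(d+4)²L²·t ≤ 1` gives the regime (Rb) for every `0 ≤ b ≤ t`, and `t ≤ 1` (`L ≥ 1`). [folklore] -/
theorem rb_of_T2 {L : ℕ} (hL : 1 ≤ L) {b t : ℝ} (hb : 0 ≤ b) (hbt : b ≤ t)
    (hT2 : 2 ^ 15 * ((d : ℝ) + 1) ^ 2 * ((d : ℝ) + 4) ^ 2 * (L : ℝ) ^ 2 * t ≤ 1) :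
    2 ^ 15 * ((d : ℝ) + 1) ^ 2 * ((d : ℝ) + 4) ^ 2 * (L : ℝ) ^ 2 * b ≤ 1 ∧ t ≤ 1 := by
  have hL1 : (1 : ℝ) ≤ L := by exact_mod_cast hL
  have hd0 : (0 : ℝ) ≤ d := Nat.cast_nonneg d
  have hK0 : 0 ≤ 2 ^ 15 * ((d : ℝ) + 1) ^ 2 * ((d : ℝ) + 4) ^ 2 * (L : ℝ) ^ 2 := by positivity
  have hK1 : 1 ≤ 2 ^ 15 * ((d : ℝ) + 1) ^ 2 * ((d : ℝ) + 4) ^ 2 * (L : ℝ) ^ 2 := by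
    have h1' : (1 : ℝ) ≤ ((d : ℝ) + 1) ^ 2 := one_le_pow₀ (by linarith)
    have h4' : (1 : ℝ) ≤ ((d : ℝ) + 4) ^ 2 := one_le_pow₀ (by linarith)
    have hL2 : (1 : ℝ) ≤ (L : ℝ) ^ 2 := one_le_pow₀ hL1
    exact one_le_mul_of_one_le_of_one_le (one_le_mul_of_one_le_of_one_le
      (one_le_mul_of_one_le_of_one_le (by norm_num) h1') h4') hL2
  have ht0 : 0 ≤ t := hb.trans hbt
  refine ⟨(mul_le_mul_of_nonneg_left hbt hK0).trans hT2, ?_⟩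
  have := mul_le_mul_of_nonneg_right hK1 ht0
  linarith

omit [Fintype n] [DecidableEq n] [Nonempty n] in
/-- The plaquette threshold of the averaged competitor from one letter: `0 ≤ b ≤ t ≤ 1` ⇒
`b + 226(8(d+1)(d+4))²b² ≤ (1 + 14464(d+1)²(d+4)²)·t`. [folklore] -/
theorem plaq_threshold_le {b t : ℝ} (hb : 0 ≤ b) (hbt : b ≤ t) (ht1 : t ≤ 1) :
    b + 226 * (8 * ((d : ℝ) + 1) * (d + 4)) ^ 2 * b ^ 2
      ≤ (1 + 14464 * ((d : ℝ) + 1) ^ 2 * ((d : ℝ) + 4) ^ 2) * t := by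
  have hd0 : (0 : ℝ) ≤ d := Nat.cast_nonneg d
  have hb1 : b ≤ 1 := hbt.trans ht1
  have hb2 : b ^ 2 ≤ t := by nlinarith
  have hK : 0 ≤ 14464 * ((d : ℝ) + 1) ^ 2 * ((d : ℝ) + 4) ^ 2 := by positivity
  have e : 226 * (8 * ((d : ℝ) + 1) * (d + 4)) ^ 2 = 14464 * ((d : ℝ) + 1) ^ 2 * ((d : ℝ) + 4) ^ 2 := by ring
  rw [e]
  have := mul_le_mul_of_nonneg_left hb2 hK
  linarith

omit [Fintype n] [DecidableEq n] [Nonempty n] in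
/-- The current threshold of the averaged competitor from one letter: `0 ≤ b ≤ t ≤ 1`, `c ≤ t`, `d ≥ 1` ⇒
`2(d−1)(c + curConst d L·b²) ≤ 2(d−1)(1 + curConst d L)·t`. [folklore] -/
theorem cur_threshold_le (hd : 1 ≤ d) (L : ℕ) {b c t : ℝ} (hb : 0 ≤ b) (hbt : b ≤ t) (hct : c ≤ t) (ht1 : t ≤ 1) :
    2 * ((d : ℝ) - 1) * (c + curConst d L * b ^ 2) ≤ 2 * ((d : ℝ) - 1) * (1 + curConst d L) * t := by
  have hd1 : (1 : ℝ) ≤ d := by exact_mod_cast hd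
  have hdm : 0 ≤ 2 * ((d : ℝ) - 1) := by linarith
  have hb1 : b ≤ 1 := hbt.trans ht1
  have hb2 : b ^ 2 ≤ t := by nlinarith
  have hK := curConst_nonneg (d := d) L
  have h1 : c + curConst d L * b ^ 2 ≤ (1 + curConst d L) * t := by
    have := mul_le_mul_of_nonneg_left hb2 hK
    linarith
  have := mul_le_mul_of_nonneg_left h1 hdm
  linarith

/-! ## §2 The END of route (A) over B11's class (6): (M2) discharged -/

/-- **NE3, ROUTE (A) — THE η-RATE OF THE MINIMAL ACTIONS OVER B11's CLASS (6) AS PRINTED FROM B11 THEOREM 1 TYPE ALONE.**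
`MinimalActionMemClass.actionRate_classSix_thm1Type` with its transport hypothesis (M2) DISCHARGED by the crew's
`BlockAverageCurrent.classSix_h4` (kinematics of (42), k-uniform): let `d ≥ 1`, `L, N ≥ 1`, `0 ≤ b ≤ t`, `0 ≤ c ≤ t`, thresholds
(i)–(iii) of part 4b, radii of the refined competitor `(K_b + 8K_mL^{d+2})·t ≤ B ≤ 1/4`, `B < ε₀`, `(K_c + 36K_mL^{d+2})·t ≤ C_r ≤ 1`,
`2(d−1)C_r < ε₀`, and the averaged competitor's thresholds `b + 226(8(d+1)(d+4))²b² < ε₀`, `2(d−1)(c + curConst d L·b²) < ε₀`.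
IF (H∃) every datum `V ∈ dom` has at every level a minimiser of the Wilson action over `ClassSix d L N ε₀` ∩ {k-fold average = V}
with sup-form regularity `(b, c)` ([Balaban1985Variational] Thm 1 p. 279 TYPE — a HYPOTHESIS over the tree's objects), THEN
`ActionRate (minActReadings d (ClassSix d L N ε₀) L N dom loc) (wallConstNA(d,L)·(gradConst d 1 + 1)/L²) (L⁻²)`.
NE3 is NOT proved by this. [folklore] -/
theorem actionRate_classSix_of_thm1Type (hd : 1 ≤ d) {L N : ℕ} (hL : 1 ≤ L) (hN : 1 ≤ N) {b c t B C_r ε₀ : ℝ}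
    (hb : 0 ≤ b) (hc : 0 ≤ c) (hbt : b ≤ t) (hct : c ≤ t) (hB0 : 0 ≤ B) (hB4 : B ≤ 1 / 4) (hBε : B < ε₀)
    (hCε : 2 * ((d : ℝ) - 1) * C_r < ε₀) (hCle : C_r ≤ 1)
    (hbε : b + 226 * (8 * ((d : ℝ) + 1) * (d + 4)) ^ 2 * b ^ 2 < ε₀)
    (hcε : 2 * ((d : ℝ) - 1) * (c + curConst d L * b ^ 2) < ε₀)
    (hT1 : (160 * d + 168 * (d : ℝ) ^ 2 + 2 * (32 * d + (24 * d * (2 * (d : ℝ) + gradRem d) + 14336 * (d : ℝ) ^ 2 * ((d : ℝ) + 1) ^ 2)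
            + 12 * (2 * (d : ℝ) + gradRem d))
        + 512 * ((d : ℝ) + 1) * ((d : ℝ) + 4) * (L : ℝ) ^ 2
          * (32 * d + 48 * d * (L : ℝ) ^ 2 * (2 * (d : ℝ) + gradRem d)
            + 8192 * (d : ℝ) ^ 2 * (2 * (d : ℝ) + 1) ^ 2 * (L : ℝ) ^ 2)) * t ≤ 1)
    (hT2 : 2 ^ 15 * ((d : ℝ) + 1) ^ 2 * ((d : ℝ) + 4) ^ 2 * (L : ℝ) ^ 2 * t ≤ 1)
    (hT3 : 2 ^ 14 * ((d : ℝ) + 1) * ((d : ℝ) + 4) * (L : ℝ) ^ (2 * d + 3)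
          * ((32 * d + 48 * d * (L : ℝ) ^ 2 * (2 * (d : ℝ) + gradRem d)
              + 8192 * (d : ℝ) ^ 2 * (2 * (d : ℝ) + 1) ^ 2 * (L : ℝ) ^ 2)
            + (3 * (1280 * d * ((d : ℝ) + 1) ^ 2 * ((d : ℝ) + 4) ^ 2 * (L : ℝ) ^ 2
            * (32 * d + 48 * d * (L : ℝ) ^ 2 * (2 * (d : ℝ) + gradRem d)
              + 8192 * (d : ℝ) ^ 2 * (2 * (d : ℝ) + 1) ^ 2 * (L : ℝ) ^ 2) ^ 2
          + d * ((d : ℝ) + 1) * ((L : ℝ) ^ 3 * (256 * (d : ℝ) ^ 2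
              * (32 * d + (24 * d * (2 * (d : ℝ) + gradRem d) + 14336 * (d : ℝ) ^ 2 * ((d : ℝ) + 1) ^ 2)
                + 12 * (2 * (d : ℝ) + gradRem d))
            + 4 * (24 * d * (2 * (d : ℝ) + gradRem d) + 14336 * (d : ℝ) ^ 2 * ((d : ℝ) + 1) ^ 2)
            + 24 * (2 * (d : ℝ) + gradRem d)))
          + ((d : ℝ) - 1) ^ 2 * (37 * ((d : ℝ) - 1) + 5)))) * t ≤ 1)
    (hB : ((32 * d + 48 * d * (L : ℝ) ^ 2 * (2 * (d : ℝ) + gradRem d)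
              + 8192 * (d : ℝ) ^ 2 * (2 * (d : ℝ) + 1) ^ 2 * (L : ℝ) ^ 2)
            + 8 * (3 * (1280 * d * ((d : ℝ) + 1) ^ 2 * ((d : ℝ) + 4) ^ 2 * (L : ℝ) ^ 2
            * (32 * d + 48 * d * (L : ℝ) ^ 2 * (2 * (d : ℝ) + gradRem d)
              + 8192 * (d : ℝ) ^ 2 * (2 * (d : ℝ) + 1) ^ 2 * (L : ℝ) ^ 2) ^ 2
          + d * ((d : ℝ) + 1) * ((L : ℝ) ^ 3 * (256 * (d : ℝ) ^ 2
              * (32 * d + (24 * d * (2 * (d : ℝ) + gradRem d) + 14336 * (d : ℝ) ^ 2 * ((d : ℝ) + 1) ^ 2)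
                + 12 * (2 * (d : ℝ) + gradRem d))
            + 4 * (24 * d * (2 * (d : ℝ) + gradRem d) + 14336 * (d : ℝ) ^ 2 * ((d : ℝ) + 1) ^ 2)
            + 24 * (2 * (d : ℝ) + gradRem d)))
          + ((d : ℝ) - 1) ^ 2 * (37 * ((d : ℝ) - 1) + 5))) * (L : ℝ) ^ (d + 2)) * t ≤ B)
    (hCr : (((L : ℝ) ^ 3 * (256 * (d : ℝ) ^ 2
              * (32 * d + (24 * d * (2 * (d : ℝ) + gradRem d) + 14336 * (d : ℝ) ^ 2 * ((d : ℝ) + 1) ^ 2)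
                + 12 * (2 * (d : ℝ) + gradRem d))
            + 4 * (24 * d * (2 * (d : ℝ) + gradRem d) + 14336 * (d : ℝ) ^ 2 * ((d : ℝ) + 1) ^ 2)
            + 24 * (2 * (d : ℝ) + gradRem d)))
            + 36 * (3 * (1280 * d * ((d : ℝ) + 1) ^ 2 * ((d : ℝ) + 4) ^ 2 * (L : ℝ) ^ 2
            * (32 * d + 48 * d * (L : ℝ) ^ 2 * (2 * (d : ℝ) + gradRem d)
              + 8192 * (d : ℝ) ^ 2 * (2 * (d : ℝ) + 1) ^ 2 * (L : ℝ) ^ 2) ^ 2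
          + d * ((d : ℝ) + 1) * ((L : ℝ) ^ 3 * (256 * (d : ℝ) ^ 2
              * (32 * d + (24 * d * (2 * (d : ℝ) + gradRem d) + 14336 * (d : ℝ) ^ 2 * ((d : ℝ) + 1) ^ 2)
                + 12 * (2 * (d : ℝ) + gradRem d))
            + 4 * (24 * d * (2 * (d : ℝ) + gradRem d) + 14336 * (d : ℝ) ^ 2 * ((d : ℝ) + 1) ^ 2)
            + 24 * (2 * (d : ℝ) + gradRem d)))
          + ((d : ℝ) - 1) ^ 2 * (37 * ((d : ℝ) - 1) + 5))) * (L : ℝ) ^ (d + 2)) * t ≤ C_r)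
    {dom : Set (Site d → Fin d → (Matrix n n ℂ)ˣ)}
    (hmin : ∀ V ∈ dom, ∀ k : ℕ, ∃ U, IsMinimiser d (ClassSix d L N ε₀) L N k V U ∧ RegularSup d L N b c k U)
    {X : Type*} (loc : ℕ → (Site d → Fin d → (Matrix n n ℂ)ˣ) → X → ℝ) :
    ActionRate (minActReadings d (ClassSix d L N ε₀) L N dom loc)
      (wallConstNA d L * (gradConst d 1 + 1) / (L : ℝ) ^ 2) (((L : ℝ) ^ 2)⁻¹) :=
  actionRate_classSix_thm1Type hd hL hN hb hc hbt hct hB0 hB4 hBε hCε hCle hT1 hT2 hT3 hB hCr hmin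
    (classSix_h4 hL hb (rb_of_T2 (d := d) hL hb hbt hT2).1 hbε hcε dom) loc

/-- **THE SAME END WITH EVERY SIDE CONDITION IN THE TWO LETTERS `t, ε₀`**: the refined competitor's radii are INSTANTIATED at
their thresholds `B := (K_b + 8K_mL^{d+2})·t`, `C_r := (K_c + 36K_mL^{d+2})·t`, and the class thresholds are read off `b, c ≤ t ≤ 1`
(§1).  Hypotheses: `d ≥ 1`, `L, N ≥ 1`, `0 ≤ b ≤ t`, `0 ≤ c ≤ t`; (i)–(iii) of part 4b; (iv′) `(K_b + 8K_mL^{d+2})·t ≤ 1/4`,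
(v′) `(K_c + 36K_mL^{d+2})·t ≤ 1`; and against the class radius: `(K_b + 8K_mL^{d+2})·t < ε₀`, `2(d−1)(K_c + 36K_mL^{d+2})·t < ε₀`,
`(1 + 14464(d+1)²(d+4)²)·t < ε₀`, `2(d−1)(1 + curConst d L)·t < ε₀`; and (H∃) over `ClassSix d L N ε₀`.  Conclusion as above.
NE3 is NOT proved by this. [folklore] -/
theorem actionRate_classSix_of_thm1Type_small (hd : 1 ≤ d) {L N : ℕ} (hL : 1 ≤ L) (hN : 1 ≤ N) {b c t ε₀ : ℝ}
    (hb : 0 ≤ b) (hc : 0 ≤ c) (hbt : b ≤ t) (hct : c ≤ t)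
    (hT1 : (160 * d + 168 * (d : ℝ) ^ 2 + 2 * (32 * d + (24 * d * (2 * (d : ℝ) + gradRem d) + 14336 * (d : ℝ) ^ 2 * ((d : ℝ) + 1) ^ 2)
            + 12 * (2 * (d : ℝ) + gradRem d))
        + 512 * ((d : ℝ) + 1) * ((d : ℝ) + 4) * (L : ℝ) ^ 2
          * (32 * d + 48 * d * (L : ℝ) ^ 2 * (2 * (d : ℝ) + gradRem d)
            + 8192 * (d : ℝ) ^ 2 * (2 * (d : ℝ) + 1) ^ 2 * (L : ℝ) ^ 2)) * t ≤ 1)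
    (hT2 : 2 ^ 15 * ((d : ℝ) + 1) ^ 2 * ((d : ℝ) + 4) ^ 2 * (L : ℝ) ^ 2 * t ≤ 1)
    (hT3 : 2 ^ 14 * ((d : ℝ) + 1) * ((d : ℝ) + 4) * (L : ℝ) ^ (2 * d + 3)
          * ((32 * d + 48 * d * (L : ℝ) ^ 2 * (2 * (d : ℝ) + gradRem d)
              + 8192 * (d : ℝ) ^ 2 * (2 * (d : ℝ) + 1) ^ 2 * (L : ℝ) ^ 2)
            + (3 * (1280 * d * ((d : ℝ) + 1) ^ 2 * ((d : ℝ) + 4) ^ 2 * (L : ℝ) ^ 2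
            * (32 * d + 48 * d * (L : ℝ) ^ 2 * (2 * (d : ℝ) + gradRem d)
              + 8192 * (d : ℝ) ^ 2 * (2 * (d : ℝ) + 1) ^ 2 * (L : ℝ) ^ 2) ^ 2
          + d * ((d : ℝ) + 1) * ((L : ℝ) ^ 3 * (256 * (d : ℝ) ^ 2
              * (32 * d + (24 * d * (2 * (d : ℝ) + gradRem d) + 14336 * (d : ℝ) ^ 2 * ((d : ℝ) + 1) ^ 2)
                + 12 * (2 * (d : ℝ) + gradRem d))
            + 4 * (24 * d * (2 * (d : ℝ) + gradRem d) + 14336 * (d : ℝ) ^ 2 * ((d : ℝ) + 1) ^ 2)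
            + 24 * (2 * (d : ℝ) + gradRem d)))
          + ((d : ℝ) - 1) ^ 2 * (37 * ((d : ℝ) - 1) + 5)))) * t ≤ 1)
    (hT4 : ((32 * d + 48 * d * (L : ℝ) ^ 2 * (2 * (d : ℝ) + gradRem d)
              + 8192 * (d : ℝ) ^ 2 * (2 * (d : ℝ) + 1) ^ 2 * (L : ℝ) ^ 2)
            + 8 * (3 * (1280 * d * ((d : ℝ) + 1) ^ 2 * ((d : ℝ) + 4) ^ 2 * (L : ℝ) ^ 2
            * (32 * d + 48 * d * (L : ℝ) ^ 2 * (2 * (d : ℝ) + gradRem d)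
              + 8192 * (d : ℝ) ^ 2 * (2 * (d : ℝ) + 1) ^ 2 * (L : ℝ) ^ 2) ^ 2
          + d * ((d : ℝ) + 1) * ((L : ℝ) ^ 3 * (256 * (d : ℝ) ^ 2
              * (32 * d + (24 * d * (2 * (d : ℝ) + gradRem d) + 14336 * (d : ℝ) ^ 2 * ((d : ℝ) + 1) ^ 2)
                + 12 * (2 * (d : ℝ) + gradRem d))
            + 4 * (24 * d * (2 * (d : ℝ) + gradRem d) + 14336 * (d : ℝ) ^ 2 * ((d : ℝ) + 1) ^ 2)
            + 24 * (2 * (d : ℝ) + gradRem d)))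
          + ((d : ℝ) - 1) ^ 2 * (37 * ((d : ℝ) - 1) + 5))) * (L : ℝ) ^ (d + 2)) * t ≤ 1 / 4)
    (hT4ε : ((32 * d + 48 * d * (L : ℝ) ^ 2 * (2 * (d : ℝ) + gradRem d)
              + 8192 * (d : ℝ) ^ 2 * (2 * (d : ℝ) + 1) ^ 2 * (L : ℝ) ^ 2)
            + 8 * (3 * (1280 * d * ((d : ℝ) + 1) ^ 2 * ((d : ℝ) + 4) ^ 2 * (L : ℝ) ^ 2
            * (32 * d + 48 * d * (L : ℝ) ^ 2 * (2 * (d : ℝ) + gradRem d)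
              + 8192 * (d : ℝ) ^ 2 * (2 * (d : ℝ) + 1) ^ 2 * (L : ℝ) ^ 2) ^ 2
          + d * ((d : ℝ) + 1) * ((L : ℝ) ^ 3 * (256 * (d : ℝ) ^ 2
              * (32 * d + (24 * d * (2 * (d : ℝ) + gradRem d) + 14336 * (d : ℝ) ^ 2 * ((d : ℝ) + 1) ^ 2)
                + 12 * (2 * (d : ℝ) + gradRem d))
            + 4 * (24 * d * (2 * (d : ℝ) + gradRem d) + 14336 * (d : ℝ) ^ 2 * ((d : ℝ) + 1) ^ 2)
            + 24 * (2 * (d : ℝ) + gradRem d)))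
          + ((d : ℝ) - 1) ^ 2 * (37 * ((d : ℝ) - 1) + 5))) * (L : ℝ) ^ (d + 2)) * t < ε₀)
    (hT5 : (((L : ℝ) ^ 3 * (256 * (d : ℝ) ^ 2
              * (32 * d + (24 * d * (2 * (d : ℝ) + gradRem d) + 14336 * (d : ℝ) ^ 2 * ((d : ℝ) + 1) ^ 2)
                + 12 * (2 * (d : ℝ) + gradRem d))
            + 4 * (24 * d * (2 * (d : ℝ) + gradRem d) + 14336 * (d : ℝ) ^ 2 * ((d : ℝ) + 1) ^ 2)
            + 24 * (2 * (d : ℝ) + gradRem d)))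
            + 36 * (3 * (1280 * d * ((d : ℝ) + 1) ^ 2 * ((d : ℝ) + 4) ^ 2 * (L : ℝ) ^ 2
            * (32 * d + 48 * d * (L : ℝ) ^ 2 * (2 * (d : ℝ) + gradRem d)
              + 8192 * (d : ℝ) ^ 2 * (2 * (d : ℝ) + 1) ^ 2 * (L : ℝ) ^ 2) ^ 2
          + d * ((d : ℝ) + 1) * ((L : ℝ) ^ 3 * (256 * (d : ℝ) ^ 2
              * (32 * d + (24 * d * (2 * (d : ℝ) + gradRem d) + 14336 * (d : ℝ) ^ 2 * ((d : ℝ) + 1) ^ 2)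
                + 12 * (2 * (d : ℝ) + gradRem d))
            + 4 * (24 * d * (2 * (d : ℝ) + gradRem d) + 14336 * (d : ℝ) ^ 2 * ((d : ℝ) + 1) ^ 2)
            + 24 * (2 * (d : ℝ) + gradRem d)))
          + ((d : ℝ) - 1) ^ 2 * (37 * ((d : ℝ) - 1) + 5))) * (L : ℝ) ^ (d + 2)) * t ≤ 1)
    (hT5ε : 2 * ((d : ℝ) - 1) * ((((L : ℝ) ^ 3 * (256 * (d : ℝ) ^ 2
              * (32 * d + (24 * d * (2 * (d : ℝ) + gradRem d) + 14336 * (d : ℝ) ^ 2 * ((d : ℝ) + 1) ^ 2)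
                + 12 * (2 * (d : ℝ) + gradRem d))
            + 4 * (24 * d * (2 * (d : ℝ) + gradRem d) + 14336 * (d : ℝ) ^ 2 * ((d : ℝ) + 1) ^ 2)
            + 24 * (2 * (d : ℝ) + gradRem d)))
            + 36 * (3 * (1280 * d * ((d : ℝ) + 1) ^ 2 * ((d : ℝ) + 4) ^ 2 * (L : ℝ) ^ 2
            * (32 * d + 48 * d * (L : ℝ) ^ 2 * (2 * (d : ℝ) + gradRem d)
              + 8192 * (d : ℝ) ^ 2 * (2 * (d : ℝ) + 1) ^ 2 * (L : ℝ) ^ 2) ^ 2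
          + d * ((d : ℝ) + 1) * ((L : ℝ) ^ 3 * (256 * (d : ℝ) ^ 2
              * (32 * d + (24 * d * (2 * (d : ℝ) + gradRem d) + 14336 * (d : ℝ) ^ 2 * ((d : ℝ) + 1) ^ 2)
                + 12 * (2 * (d : ℝ) + gradRem d))
            + 4 * (24 * d * (2 * (d : ℝ) + gradRem d) + 14336 * (d : ℝ) ^ 2 * ((d : ℝ) + 1) ^ 2)
            + 24 * (2 * (d : ℝ) + gradRem d)))
          + ((d : ℝ) - 1) ^ 2 * (37 * ((d : ℝ) - 1) + 5))) * (L : ℝ) ^ (d + 2)) * t) < ε₀)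
    (hT6ε : (1 + 14464 * ((d : ℝ) + 1) ^ 2 * ((d : ℝ) + 4) ^ 2) * t < ε₀)
    (hT7ε : 2 * ((d : ℝ) - 1) * (1 + curConst d L) * t < ε₀)
    {dom : Set (Site d → Fin d → (Matrix n n ℂ)ˣ)}
    (hmin : ∀ V ∈ dom, ∀ k : ℕ, ∃ U, IsMinimiser d (ClassSix d L N ε₀) L N k V U ∧ RegularSup d L N b c k U)
    {X : Type*} (loc : ℕ → (Site d → Fin d → (Matrix n n ℂ)ˣ) → X → ℝ) :
    ActionRate (minActReadings d (ClassSix d L N ε₀) L N dom loc)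
      (wallConstNA d L * (gradConst d 1 + 1) / (L : ℝ) ^ 2) (((L : ℝ) ^ 2)⁻¹) := by
  have ht1 := (rb_of_T2 (d := d) hL hb hbt hT2).2
  have ht0 : 0 ≤ t := hb.trans hbt
  have hd0 : (0 : ℝ) ≤ d := Nat.cast_nonneg d
  have hd1 : (1 : ℝ) ≤ d := by exact_mod_cast hd
  have hΓ := gradRem_nonneg hd
  have h37 : 0 ≤ 37 * ((d : ℝ) - 1) + 5 := by linarith
  have hB0 : 0 ≤ ((32 * d + 48 * d * (L : ℝ) ^ 2 * (2 * (d : ℝ) + gradRem d)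
              + 8192 * (d : ℝ) ^ 2 * (2 * (d : ℝ) + 1) ^ 2 * (L : ℝ) ^ 2)
            + 8 * (3 * (1280 * d * ((d : ℝ) + 1) ^ 2 * ((d : ℝ) + 4) ^ 2 * (L : ℝ) ^ 2
            * (32 * d + 48 * d * (L : ℝ) ^ 2 * (2 * (d : ℝ) + gradRem d)
              + 8192 * (d : ℝ) ^ 2 * (2 * (d : ℝ) + 1) ^ 2 * (L : ℝ) ^ 2) ^ 2
          + d * ((d : ℝ) + 1) * ((L : ℝ) ^ 3 * (256 * (d : ℝ) ^ 2
              * (32 * d + (24 * d * (2 * (d : ℝ) + gradRem d) + 14336 * (d : ℝ) ^ 2 * ((d : ℝ) + 1) ^ 2)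
                + 12 * (2 * (d : ℝ) + gradRem d))
            + 4 * (24 * d * (2 * (d : ℝ) + gradRem d) + 14336 * (d : ℝ) ^ 2 * ((d : ℝ) + 1) ^ 2)
            + 24 * (2 * (d : ℝ) + gradRem d)))
          + ((d : ℝ) - 1) ^ 2 * (37 * ((d : ℝ) - 1) + 5))) * (L : ℝ) ^ (d + 2)) * t := by positivity
  exact actionRate_classSix_of_thm1Type hd hL hN hb hc hbt hct hB0 hT4 hT4ε hT5ε hT5
    ((plaq_threshold_le (d := d) hb hbt ht1).trans_lt hT6ε) ((cur_threshold_le hd L hb hbt hct ht1).trans_lt hT7ε)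
    hT1 hT2 hT3 le_rfl le_rfl hmin loc

/-! ## §3 Both readings by name on the fixed torus over class (6): (M2) discharged -/

/-- **NE3 BY NAME ON THE FIXED TORUS OVER B11's CLASS (6) AS PRINTED, FROM (H∃) AND T-E** (`d = 4`, `L ≥ 2`):
`NE3ShapeClassSixTorus.ne3Shape_classSix_crude` with its transport hypothesis (M2) DISCHARGED by `BlockAverageCurrent.classSix_h4`.
Typed hypotheses: (H∃) in choice form (a selection `sel k V` of minimisers of Bałaban's variational problem over (6) with sup-form
regularity `(b, c)` — [Balaban1985Variational] Thm 1 p. 279 TYPE) and T-E (`NE3EnergyRate` over (6) — P2's ROOT), plus the regime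
of §2 (thresholds (i)–(iii), the refined radii `(B, C_r)`, the two class thresholds of the averaged competitor).  Conclusion:
`NE3Shape (minActReadings d (ClassSix d L N ε₀) L N dom loc_D) (max C_A K_D) (L⁻¹)` with the crude fixed-torus local constant
`K_D ∝ N⁴`.  NE3 is NOT proved by this. [folklore] -/
theorem ne3Shape_classSix_of_energyRate (hd4 : d = 4) {L N : ℕ} (hL : 2 ≤ L) (hN : 1 ≤ N) {b c t B C_r C ε₀ : ℝ}
    (hb : 0 ≤ b) (hc : 0 ≤ c) (hbt : b ≤ t) (hct : c ≤ t) (hC : 0 ≤ C) (hB0 : 0 ≤ B) (hB4 : B ≤ 1 / 4) (hBε : B < ε₀)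
    (hCε : 2 * ((d : ℝ) - 1) * C_r < ε₀) (hCle : C_r ≤ 1)
    (hbε : b + 226 * (8 * ((d : ℝ) + 1) * (d + 4)) ^ 2 * b ^ 2 < ε₀)
    (hcε : 2 * ((d : ℝ) - 1) * (c + curConst d L * b ^ 2) < ε₀)
    (hT1 : (160 * d + 168 * (d : ℝ) ^ 2 + 2 * (32 * d + (24 * d * (2 * (d : ℝ) + gradRem d) + 14336 * (d : ℝ) ^ 2 * ((d : ℝ) + 1) ^ 2)
            + 12 * (2 * (d : ℝ) + gradRem d))
        + 512 * ((d : ℝ) + 1) * ((d : ℝ) + 4) * (L : ℝ) ^ 2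
          * (32 * d + 48 * d * (L : ℝ) ^ 2 * (2 * (d : ℝ) + gradRem d)
            + 8192 * (d : ℝ) ^ 2 * (2 * (d : ℝ) + 1) ^ 2 * (L : ℝ) ^ 2)) * t ≤ 1)
    (hT2 : 2 ^ 15 * ((d : ℝ) + 1) ^ 2 * ((d : ℝ) + 4) ^ 2 * (L : ℝ) ^ 2 * t ≤ 1)
    (hT3 : 2 ^ 14 * ((d : ℝ) + 1) * ((d : ℝ) + 4) * (L : ℝ) ^ (2 * d + 3)
          * ((32 * d + 48 * d * (L : ℝ) ^ 2 * (2 * (d : ℝ) + gradRem d)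
              + 8192 * (d : ℝ) ^ 2 * (2 * (d : ℝ) + 1) ^ 2 * (L : ℝ) ^ 2)
            + (3 * (1280 * d * ((d : ℝ) + 1) ^ 2 * ((d : ℝ) + 4) ^ 2 * (L : ℝ) ^ 2
            * (32 * d + 48 * d * (L : ℝ) ^ 2 * (2 * (d : ℝ) + gradRem d)
              + 8192 * (d : ℝ) ^ 2 * (2 * (d : ℝ) + 1) ^ 2 * (L : ℝ) ^ 2) ^ 2
          + d * ((d : ℝ) + 1) * ((L : ℝ) ^ 3 * (256 * (d : ℝ) ^ 2
              * (32 * d + (24 * d * (2 * (d : ℝ) + gradRem d) + 14336 * (d : ℝ) ^ 2 * ((d : ℝ) + 1) ^ 2)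
                + 12 * (2 * (d : ℝ) + gradRem d))
            + 4 * (24 * d * (2 * (d : ℝ) + gradRem d) + 14336 * (d : ℝ) ^ 2 * ((d : ℝ) + 1) ^ 2)
            + 24 * (2 * (d : ℝ) + gradRem d)))
          + ((d : ℝ) - 1) ^ 2 * (37 * ((d : ℝ) - 1) + 5)))) * t ≤ 1)
    (hB : ((32 * d + 48 * d * (L : ℝ) ^ 2 * (2 * (d : ℝ) + gradRem d)
              + 8192 * (d : ℝ) ^ 2 * (2 * (d : ℝ) + 1) ^ 2 * (L : ℝ) ^ 2)
            + 8 * (3 * (1280 * d * ((d : ℝ) + 1) ^ 2 * ((d : ℝ) + 4) ^ 2 * (L : ℝ) ^ 2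
            * (32 * d + 48 * d * (L : ℝ) ^ 2 * (2 * (d : ℝ) + gradRem d)
              + 8192 * (d : ℝ) ^ 2 * (2 * (d : ℝ) + 1) ^ 2 * (L : ℝ) ^ 2) ^ 2
          + d * ((d : ℝ) + 1) * ((L : ℝ) ^ 3 * (256 * (d : ℝ) ^ 2
              * (32 * d + (24 * d * (2 * (d : ℝ) + gradRem d) + 14336 * (d : ℝ) ^ 2 * ((d : ℝ) + 1) ^ 2)
                + 12 * (2 * (d : ℝ) + gradRem d))
            + 4 * (24 * d * (2 * (d : ℝ) + gradRem d) + 14336 * (d : ℝ) ^ 2 * ((d : ℝ) + 1) ^ 2)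
            + 24 * (2 * (d : ℝ) + gradRem d)))
          + ((d : ℝ) - 1) ^ 2 * (37 * ((d : ℝ) - 1) + 5))) * (L : ℝ) ^ (d + 2)) * t ≤ B)
    (hCr : (((L : ℝ) ^ 3 * (256 * (d : ℝ) ^ 2
              * (32 * d + (24 * d * (2 * (d : ℝ) + gradRem d) + 14336 * (d : ℝ) ^ 2 * ((d : ℝ) + 1) ^ 2)
                + 12 * (2 * (d : ℝ) + gradRem d))
            + 4 * (24 * d * (2 * (d : ℝ) + gradRem d) + 14336 * (d : ℝ) ^ 2 * ((d : ℝ) + 1) ^ 2)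
            + 24 * (2 * (d : ℝ) + gradRem d)))
            + 36 * (3 * (1280 * d * ((d : ℝ) + 1) ^ 2 * ((d : ℝ) + 4) ^ 2 * (L : ℝ) ^ 2
            * (32 * d + 48 * d * (L : ℝ) ^ 2 * (2 * (d : ℝ) + gradRem d)
              + 8192 * (d : ℝ) ^ 2 * (2 * (d : ℝ) + 1) ^ 2 * (L : ℝ) ^ 2) ^ 2
          + d * ((d : ℝ) + 1) * ((L : ℝ) ^ 3 * (256 * (d : ℝ) ^ 2
              * (32 * d + (24 * d * (2 * (d : ℝ) + gradRem d) + 14336 * (d : ℝ) ^ 2 * ((d : ℝ) + 1) ^ 2)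
                + 12 * (2 * (d : ℝ) + gradRem d))
            + 4 * (24 * d * (2 * (d : ℝ) + gradRem d) + 14336 * (d : ℝ) ^ 2 * ((d : ℝ) + 1) ^ 2)
            + 24 * (2 * (d : ℝ) + gradRem d)))
          + ((d : ℝ) - 1) ^ 2 * (37 * ((d : ℝ) - 1) + 5))) * (L : ℝ) ^ (d + 2)) * t ≤ C_r)
    {dom : Set (Site d → Fin d → (Matrix n n ℂ)ˣ)} (hTE : NE3EnergyRate d (ClassSix d L N ε₀) L N b (gradConst d c) C dom)
    {sel : ℕ → (Site d → Fin d → (Matrix n n ℂ)ˣ) → (Site d → Fin d → (Matrix n n ℂ)ˣ)}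
    (hmin : ∀ V ∈ dom, ∀ k, IsMinimiser d (ClassSix d L N ε₀) L N k V (sel k V))
    (hreg : ∀ V ∈ dom, ∀ k, RegularSup d L N b c k (sel k V)) :
    NE3Shape
      (minActReadings d (ClassSix d L N ε₀) L N dom
        (fun k V (x : ↥(periodBox (d := d) N)) =>
          fineAction (sel k V) (((blockSites L)^[k] {(x : Site d)}) ×ˢ Finset.univ)))
      (max (wallConstNA d L * (gradConst d 1 + 1) / (L : ℝ) ^ 2)
        (wallConstLoc d L * (2500 * (L : ℝ) ^ 3 * Fintype.card (T4AveragingDeficitWall.Plane d) * (b * c + c ^ 2) + b ^ 3)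
          + ((b + 23142400 * b ^ 2) * Real.sqrt (Fintype.card (T4AveragingDeficitWall.Plane d))
              * (C * (wallConst d L * (N : ℝ) ^ 2 * (Real.sqrt (gradConst d c) * dualC2 d L + 2 * b ^ 2 * dualC1 d L)))
            + 14 * Fintype.card (T4AveragingDeficitWall.Plane d)
              * (C * (wallConst d L * (N : ℝ) ^ 2 * (Real.sqrt (gradConst d c) * dualC2 d L + 2 * b ^ 2 * dualC1 d L))) ^ 2)
        + Fintype.card (T4AveragingDeficitWall.Plane d) * b ^ 2))
      ((L : ℝ)⁻¹) := by
  have hL1 : 1 ≤ L := le_trans (by norm_num) hL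
  exact ne3Shape_classSix_crude hd4 hL hN hb hc hbt hct hC hB0 hB4 hBε hCε hCle hT1 hT2 hT3 hB hCr hTE hmin hreg
    (classSix_h4 hL1 hb (rb_of_T2 (d := d) hL1 hb hbt hT2).1 hbε hcε dom)

/-! ## §4 Non-vacuity of everything but (H∃) and T-E -/

/-- NON-VACUITY of §2 at `t = 0`: for the flat datum (`dom = {1}`) and every `ε₀ > 0` all hypotheses of
`actionRate_classSix_of_thm1Type_small` are met — (H∃) by the flat configuration itself (regularity `(0, 0)`), the nine numeric
inequalities trivially — so the END yields `ActionRate` for Bałaban's class (6).  (A consistency check of the hypothesis set, not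
a statement about non-flat data.) [folklore] -/
theorem actionRate_classSix_of_thm1Type_flat (hd : 1 ≤ d) {L N : ℕ} (hL : 1 ≤ L) (hN : 1 ≤ N) {ε₀ : ℝ} (hε : 0 < ε₀)
    {X : Type*} (loc : ℕ → (Site d → Fin d → (Matrix n n ℂ)ˣ) → X → ℝ) :
    ActionRate (minActReadings d (ClassSix d L N ε₀) L N {(flatCfg : Site d → Fin d → (Matrix n n ℂ)ˣ)} loc)
      (wallConstNA d L * (gradConst d 1 + 1) / (L : ℝ) ^ 2) (((L : ℝ) ^ 2)⁻¹) := by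
  refine actionRate_classSix_of_thm1Type_small hd hL hN (b := 0) (c := 0) (t := 0) le_rfl le_rfl le_rfl le_rfl
    (by rw [mul_zero]; exact zero_le_one) (by rw [mul_zero]; exact zero_le_one) (by rw [mul_zero]; exact zero_le_one)
    (by rw [mul_zero]; norm_num) (by rw [mul_zero]; exact hε) (by rw [mul_zero]; exact zero_le_one)
    (by rw [mul_zero, mul_zero]; exact hε) (by rw [mul_zero]; exact hε) (by rw [mul_zero]; exact hε) ?_ loc
  intro V hV k
  rw [Set.mem_singleton_iff] at hV
  subst hV
  -- the flat configuration minimises every run of the flat datum over (6) ⊆ `sfClass ε₀` (`MinimalActionWitness`)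
  have h := isMinimiser_sfClass_flatCfg (n := n) (d := d) hL N hε.le k
  exact ⟨flatCfg, ⟨⟨flatCfg_mem_classSix hL N hε k, h.1.2⟩,
    fun U hU => h.2 U ⟨classSix_subset_sfClass d L N ε₀ k hU.1, hU.2⟩⟩, regularSup_flatCfg L N k le_rfl le_rfl⟩

end

end Summit.QuantumFields.BalabanUV.T4Continuum.MinimalActionClassSixEnd
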